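import Mathlib
import Summits.ValiantsHypothesis.ValiantsHypothesis.Theorems.BarrierLeverPartitionMinorsHitByVPHiddenStatesJoin
import Summits.ValiantsHypothesis.ValiantsHypothesis.Theorems.BarrierLeverPartitionMinorsHitByVPStubJoinDoorWide

/-!
# Route BarrierLever — item `PartitionMinorsHitByVP` (stmt-ValiantsHypothesis-19717), line `hidden_states`:
# THE FULL-JOIN DOOR — no threshold family, no Cauchy–Binet leading term: the WHOLE hidden sum (part 1/2: the door)

Helper file (`--supports stmt-ValiantsHypothesis-19717`; cell valiant-natproofs, rung V4, 𝒟-side door (c), line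
`Cruxes/PartitionMinorsHitByVP/Lines/hidden_states.lean` v8; prover seat val-np-p3 gen 16). Definition-free. Closes NO item.

THE POINT (memo val-np-p3 g16 «full join», evidence on 19717). Every door of the line so far (`…HiddenStates`,
`…HiddenStatesJoin`, `…StubJoinDoorWide`) reads the partition matrix of the join witness
`F = Σ_p κ_p · ∏_v (1 + tab_p none v X_v) · ∏_k (1 + λ_{pk} ∏_v (1 + tab_p (some k) v X_v))` on a layout `(u, w)` as
`Σ_{(p,J)} κ_p λ_p^J · A[i,(p,J)] · B[j,(p,J)]` (`coeff_partition_joinWitness`) and then ISOLATES ONE TERM of its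
Cauchy–Binet expansion by a threshold (legal) column family `e` — so the hypothesis is «both square factors `A[·,e]`,
`B[·,e]` nonsingular». That isolation is a proof device, not a requirement of the algebra: the layout is hit as soon as
the FULL block-additive sum
`M[i,j] = Σ_p Σ_{J ⊆ Fin K} κ_p (∏_{k∈J} λ_{pk}) · ∏_{a∈u i}(tx p none a + Σ_{q∈J} tx p (some q) a) · ∏_{c∈w j}(ty p none c + Σ_{q∈J} ty p (some q) c)`
is nonsingular for SOME tables and SOME weights: `partitionMinor_hit_of_fullJoin` (explicit size) and
`partitionMinor_hit_of_fullJoin_mem` (`m ≤ 2h`, `K ≤ h³`, `h ≥ 3` ⇒ `SmallCircuits ℂ (h+h) 8`, size arithmetic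
`HiddenStatesLine.joinDoorWide_size`). The old hypothesis is a special case: a legal threshold design good on both sides
makes the full sum nonsingular for the weights `κ_p = t₀^{W p}`, `λ_{pk} = t₀^{wt p k}` (`fullJoin_det_ne_zero_of_threshold`,
via `exists_eval_det_hiddenSum_ne_zero`). Part 2/2 (`…HiddenStatesFullJoin`) types the corresponding pair nodes.

WHY IT MATTERS. `det M` is a polynomial in the weights whose EXTREMAL coefficients are the products `det A[·,S]·det B[·,S]`
over all linearly separable `S ⊆ {0,1}^K` of size `r` (one cube); it is nonzero as soon as ONE separable `S` — which may
depend on the pair `(u, w)` — is good on both sides, and can be nonzero when none is. Numerically (seat lab/fulljoin*.py):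
ONE cube with `K = h` states and the FULL sum is nonsingular for EVERY pair of lower families at `h ≤ 5` (exhaustive) and
in all 1 650 sampled lower pairs at `h = 6, 7`, including the star-layer families on which the graded-colex one-sided
design is singular (`BallDiag.det_eq_zero_of_shadow`).

WHAT THIS IS NOT: no lower pair is certified here beyond what the hypotheses give; item 19717 stays OPEN; nothing on crux
14610 or VP ≠ VNP.
-/

set_option linter.dupNamespace false

namespace Summit.ValiantsHypothesis.ValiantsHypothesis.Theorems.BarrierLever.HiddenStates

open Finset MvPolynomial Matrix
open Literature.Barriers.ValiantsHypothesis Literature.Computability.AlgebraicComplexity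
open Summit.ValiantsHypothesis.ValiantsHypothesis.Theorems.BarrierLever.AdditiveDoor
  (truncation_spec degree_partitionExpo_le)

noncomputable section

namespace FullJoin

/-! ## 1. The full-join door -/

/-- **THE FULL-JOIN DOOR (explicit size).** If for some per-piece tables `tx, ty`, piece weights `κ` and state weights
`λ` the FULL block-additive sum over all `(p, J)`, `J ⊆ Fin K`, is a nonsingular `r × r` matrix on the layout `(u, w)`,
then some `f` of degree `≤ 2h` and size `≤ (2h+2)²·(m(6h + K(6h+2) + K + 3) + m) + 2h + 1` has a nonsingular partition
matrix on `(u, w)` (the truncated join witness itself). -/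
theorem partitionMinor_hit_of_fullJoin (h m K r : ℕ) (u w : Fin r → Finset (Fin h))
    (tx ty : Fin m → Option (Fin K) → Fin h → ℂ) (kap : Fin m → ℂ) (lam : Fin m → Fin K → ℂ)
    (hdet : (Matrix.of fun i j : Fin r => ∑ p : Fin m, ∑ J : Finset (Fin K), kap p * (∏ k ∈ J, lam p k) *
        ((∏ a ∈ u i, (tx p none a + ∑ q ∈ J, tx p (some q) a)) *
          ∏ c ∈ w j, (ty p none c + ∑ q ∈ J, ty p (some q) c))).det ≠ 0) :
    ∃ f : MvPolynomial (Fin (h + h)) ℂ, f.totalDegree ≤ h + h ∧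
      complexity f ≤ (h + h + 2) ^ 2 * (m * (3 * (h + h) + (K * (3 * (h + h) + 2) + K) + 1 + 2) + m) +
        (h + h + 1) ∧
      (Matrix.of fun i j : Fin r => MvPolynomial.coeff
        (∑ a ∈ u i, Finsupp.single (Fin.castAdd h a) 1 +
          ∑ c ∈ w j, Finsupp.single (Fin.natAdd h c) 1) f).det ≠ 0 := by
  classical
  -- the witness: per-piece combined tables on `Fin (h + h)`
  set tab : Fin m → Option (Fin K) → Fin (h + h) → ℂ :=
    fun p o v => Fin.addCases (tx p o) (ty p o) v with htab
  set F : MvPolynomial (Fin (h + h)) ℂ := ∑ p : Fin m, C (kap p) *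
    ((∏ v : Fin (h + h), (1 + C (tab p none v) * X v)) *
      ∏ k : Fin K, (1 + C (lam p k) * ∏ v : Fin (h + h), (1 + C (tab p (some k) v) * X v))) with hF
  obtain ⟨hdeg, hcoeff, hsize⟩ := truncation_spec F (h + h)
  refine ⟨∑ d ∈ Finset.range (h + h + 1), homogeneousComponent d F, hdeg, ?_, ?_⟩
  · exact hsize.trans (by have := complexity_joinWitness_le tab lam kap; rw [← hF] at this; gcongr)
  · have hmat : (Matrix.of fun i j : Fin r => MvPolynomial.coeff
        (∑ a ∈ u i, Finsupp.single (Fin.castAdd h a) 1 +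
          ∑ c ∈ w j, Finsupp.single (Fin.natAdd h c) 1)
        (∑ d ∈ Finset.range (h + h + 1), homogeneousComponent d F)) =
        Matrix.of fun i j : Fin r => ∑ p : Fin m, ∑ J : Finset (Fin K), kap p * (∏ k ∈ J, lam p k) *
          ((∏ a ∈ u i, (tx p none a + ∑ q ∈ J, tx p (some q) a)) *
            ∏ c ∈ w j, (ty p none c + ∑ q ∈ J, ty p (some q) c)) := by
      refine Matrix.ext fun i j => ?_
      rw [Matrix.of_apply, Matrix.of_apply, hcoeff _ (degree_partitionExpo_le _ _), hF,
        coeff_partition_joinWitness]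
      refine Finset.sum_congr rfl fun p _ => Finset.sum_congr rfl fun J _ => ?_
      simp only [htab, Fin.addCases_left, Fin.addCases_right]
    rw [hmat]
    exact hdet

/-- **THE FULL-JOIN DOOR (class form).** With `m ≤ 2h` pieces of `K ≤ h³` states and `h ≥ 3` the witness lies in
`SmallCircuits ℂ (h+h) 8` (size arithmetic `HiddenStatesLine.joinDoorWide_size`). -/
theorem partitionMinor_hit_of_fullJoin_mem (h m K r : ℕ) (hh : 3 ≤ h) (hm : m ≤ h + h) (hK : K ≤ h * h * h)
    (u w : Fin r → Finset (Fin h))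
    (tx ty : Fin m → Option (Fin K) → Fin h → ℂ) (kap : Fin m → ℂ) (lam : Fin m → Fin K → ℂ)
    (hdet : (Matrix.of fun i j : Fin r => ∑ p : Fin m, ∑ J : Finset (Fin K), kap p * (∏ k ∈ J, lam p k) *
        ((∏ a ∈ u i, (tx p none a + ∑ q ∈ J, tx p (some q) a)) *
          ∏ c ∈ w j, (ty p none c + ∑ q ∈ J, ty p (some q) c))).det ≠ 0) :
    ∃ f ∈ SmallCircuits ℂ (h + h) 8,
      (Matrix.of fun i j : Fin r => MvPolynomial.coeff
        (∑ a ∈ u i, Finsupp.single (Fin.castAdd h a) 1 +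
          ∑ c ∈ w j, Finsupp.single (Fin.natAdd h c) 1) f).det ≠ 0 := by
  obtain ⟨f, hdeg, hsize, hf⟩ := partitionMinor_hit_of_fullJoin h m K r u w tx ty kap lam hdet
  exact ⟨f, ⟨hdeg, hsize.trans (HiddenStatesLine.joinDoorWide_size h m K hh hm hK)⟩, hf⟩

/-! ## 2. The old hypothesis is a special case -/

/-- **A legal threshold design good on both sides makes the full join nonsingular.** With `κ_p = t₀^{W p}`,
`λ_{pk} = t₀^{wt p k}` the design's product `det A[·,e]·det B[·,e]` is the `t₀`-leading coefficient of the full sum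
(`exists_eval_det_hiddenSum_ne_zero`), so some `t₀` works. -/
theorem fullJoin_det_ne_zero_of_threshold (h m K r : ℕ) (u w : Fin r → Finset (Fin h))
    (e : Fin r → Fin m × Finset (Fin K)) (he : Function.Injective e) (W : Fin m → ℕ) (wt : Fin m → Fin K → ℕ)
    (hthr : ∀ x : Fin m × Finset (Fin K), x ∉ Set.range e →
      ∀ i, W (e i).1 + ∑ k ∈ (e i).2, wt (e i).1 k < W x.1 + ∑ k ∈ x.2, wt x.1 k)
    (tx ty : Fin m → Option (Fin K) → Fin h → ℂ)
    (hx : (Matrix.of fun i k : Fin r =>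
      ∏ a ∈ u i, (tx (e k).1 none a + ∑ q ∈ (e k).2, tx (e k).1 (some q) a)).det ≠ 0)
    (hy : (Matrix.of fun j k : Fin r =>
      ∏ c ∈ w j, (ty (e k).1 none c + ∑ q ∈ (e k).2, ty (e k).1 (some q) c)).det ≠ 0) :
    ∃ t₀ : ℂ, (Matrix.of fun i j : Fin r => ∑ p : Fin m, ∑ J : Finset (Fin K),
        t₀ ^ W p * (∏ k ∈ J, t₀ ^ wt p k) *
        ((∏ a ∈ u i, (tx p none a + ∑ q ∈ J, tx p (some q) a)) *
          ∏ c ∈ w j, (ty p none c + ∑ q ∈ J, ty p (some q) c))).det ≠ 0 := by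
  classical
  -- the two block-additive matrices over ALL hidden states of the disjoint union
  set A : Matrix (Fin r) (Fin m × Finset (Fin K)) ℂ :=
    Matrix.of fun i x => ∏ a ∈ u i, (tx x.1 none a + ∑ q ∈ x.2, tx x.1 (some q) a) with hA
  set B : Matrix (Fin r) (Fin m × Finset (Fin K)) ℂ :=
    Matrix.of fun j x => ∏ c ∈ w j, (ty x.1 none c + ∑ q ∈ x.2, ty x.1 (some q) c) with hB
  set ω : Fin m × Finset (Fin K) → ℕ := fun x => W x.1 + ∑ k ∈ x.2, wt x.1 k with hω
  have hAe : (A.submatrix id e).det ≠ 0 := hx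
  have hBe : (B.submatrix id e).det ≠ 0 := hy
  have hthr' : ∀ x, x ∉ Set.range e → ∀ i, ω (e i) < ω x := fun x hxr i => hthr x hxr i
  obtain ⟨t₀, ht₀⟩ := exists_eval_det_hiddenSum_ne_zero A B ω e he hthr' hAe hBe
  refine ⟨t₀, ?_⟩
  have hmat : (Matrix.of fun i j : Fin r => ∑ p : Fin m, ∑ J : Finset (Fin K),
      t₀ ^ W p * (∏ k ∈ J, t₀ ^ wt p k) *
        ((∏ a ∈ u i, (tx p none a + ∑ q ∈ J, tx p (some q) a)) *
          ∏ c ∈ w j, (ty p none c + ∑ q ∈ J, ty p (some q) c))) =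
      Matrix.of fun i j : Fin r => ∑ x : Fin m × Finset (Fin K), A i x * B j x * t₀ ^ ω x := by
    refine Matrix.ext fun i j => ?_
    rw [Matrix.of_apply, Matrix.of_apply, Fintype.sum_prod_type]
    refine Finset.sum_congr rfl fun p _ => Finset.sum_congr rfl fun J _ => ?_
    have hl : ∏ k ∈ J, t₀ ^ wt p k = t₀ ^ (∑ k ∈ J, wt p k) := Finset.prod_pow_eq_pow_sum J (wt p) t₀
    have hk : t₀ ^ W p * t₀ ^ (∑ k ∈ J, wt p k) = t₀ ^ ω (p, J) := by rw [hω, pow_add]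
    rw [hl, hA, hB]
    simp only [Matrix.of_apply]
    rw [← hk]
    ring
  rw [hmat]
  exact ht₀

/-- **The wide join door (registered stub 1, `HiddenStatesLine.stub_joinDoorWide`) re-derived through the full join** —
sanity check that nothing is lost. -/
theorem partitionMinor_hit_of_threshold_via_fullJoin (h m K r : ℕ) (hh : 3 ≤ h) (hm : m ≤ h + h)
    (hK : K ≤ h * h * h) (u w : Fin r → Finset (Fin h))
    (e : Fin r → Fin m × Finset (Fin K)) (he : Function.Injective e) (W : Fin m → ℕ) (wt : Fin m → Fin K → ℕ)
    (hthr : ∀ x : Fin m × Finset (Fin K), x ∉ Set.range e →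
      ∀ i, W (e i).1 + ∑ k ∈ (e i).2, wt (e i).1 k < W x.1 + ∑ k ∈ x.2, wt x.1 k)
    (tx ty : Fin m → Option (Fin K) → Fin h → ℂ)
    (hx : (Matrix.of fun i k : Fin r =>
      ∏ a ∈ u i, (tx (e k).1 none a + ∑ q ∈ (e k).2, tx (e k).1 (some q) a)).det ≠ 0)
    (hy : (Matrix.of fun j k : Fin r =>
      ∏ c ∈ w j, (ty (e k).1 none c + ∑ q ∈ (e k).2, ty (e k).1 (some q) c)).det ≠ 0) :
    ∃ f ∈ SmallCircuits ℂ (h + h) 8,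
      (Matrix.of fun i j : Fin r => MvPolynomial.coeff
        (∑ a ∈ u i, Finsupp.single (Fin.castAdd h a) 1 +
          ∑ c ∈ w j, Finsupp.single (Fin.natAdd h c) 1) f).det ≠ 0 := by
  obtain ⟨t₀, ht₀⟩ := fullJoin_det_ne_zero_of_threshold h m K r u w e he W wt hthr tx ty hx hy
  exact partitionMinor_hit_of_fullJoin_mem h m K r hh hm hK u w tx ty (fun p => t₀ ^ W p)
    (fun p k => t₀ ^ wt p k) ht₀

end FullJoin

end

end Summit.ValiantsHypothesis.ValiantsHypothesis.Theorems.BarrierLever.HiddenStates
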